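import Literature.AnabelianGeometry.SemiGraphs.TemperedCompactInVerticialFinite
import Literature.AnabelianGeometry.SemiGraphs.CompactInVerticialAtCoveringGraphCorollaries
import Literature.AnabelianGeometry.SemiGraphs.CoveringGraphHereditary
import Literature.AnabelianGeometry.SemiGraphs.ThetaRayExoticMaximalCompactAnchorFree
import Literature.AnabelianGeometry.SemiGraphs.ThetaRayAnchorFreePair
import Literature.AnabelianGeometry.SemiGraphs.ThetaRayRefutationMaximalCompact
import Literature.AnabelianGeometry.SemiGraphs.ThetaRayRefutation
import HarnessLib

/-!
# [SemiAnbd] Thm 3.7 (iv) — NODE-LEVEL RE-CLOSE at the carriers of record (cone node `SemiAnbd:Thm3.7(iv)`)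

Mochizuki, *Semi-graphs of anabelioids*, Publ. RIMS **42** (2006) 221–322, §3, Theorem 3.7 (iv), manuscript
p. 41 [cite: MochizukiSemiAnbd2006, Thm 3.7(iv) p.41]: "The maximal compact subgroups of `π₁^temp(𝒢)` are
precisely the verticial subgroups of `π₁^temp(𝒢)`.  The nontrivial intersections of two distinct maximal compact
subgroups of `π₁^temp(𝒢)` are precisely the edge-like subgroups of `π₁^temp(𝒢)`"; print's proof (p. 41, l. 1 of
the proof of (iii): "Since the semi-graphs `𝔾_j` are all finite …") derives (iv) from (iii) and runs for FINITE
underlying semi-graphs.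

PROOF-ONLY file (abc-iut cell, layer L3, cone row `SemiAnbd:Thm3.7(iv)`, kernel id `N_SemiAnbd_Thm3_7_iv`;
seat abc-iut-w6-d064 gen 6, L3-lead ruling γ46 «K4 RE-CLOSE of F-1750 at the anchored/escaping-pair
instances, BY NAME»; 0 definitions, no new named fact, the frozen node file `TemperedVerticial.lean` untouched).
The cell's ∀-countable typing of (iv) is the named fact `MaximalCompactIffVerticial` (FACT-LIST F-1750), which is
REFUTED AS TYPED in the kernel (abc-iut-w6-d120, `not_maximalCompactIffVerticial`, countermodel `𝒢_θ`).  This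
file states, BY NAME and with no new mathematics beyond three short corollaries, exactly what the tree proves of
Thm 3.7 (iv) — the per-graph body `MaximalCompactIffVerticialAt 𝒢` (abc-iut-w4-d075) — at each carrier class
of record (plan/L3/LF-SGA.tsv row F-1750, NODES.md v2.35/v2.36/v2.42):

* §1 print's own derivation at ONE graph: (iv) at `𝒢` from (iii) at `𝒢` (abc-iut-w4-d075 / abc-iut-L3-t11,
  `maximalCompactIffVerticialAt_of_compactInVerticialAt`; Thm 3.7 (i)/(ii) are theorems of the tree);
* §2 every FINITE `𝔾` — print's proof scope — UNCONDITIONALLY (abc-iut-L3-t8/t10/w4-d064,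
  `maximalCompactIffVerticialAt_of_finiteGraph`, p431007/p432601);
* §3 the — in general INFINITE — covering semi-graph `𝒢_S` of every connected tempered covering `S` of a finite
  coherent Thm-3.7 graph (the universal graph-coverings of [EtTh] §1 are of this form), and every stage of a
  route-T tower (abc-iut-L3-d6, p456054);
* §4 every countable LOCALLY FINITE `𝒢`: «verticial ⇒ maximal compact» and «edge-like ⇒ intersection of two
  distinct maximal compact subgroups» UNCONDITIONALLY, and both converses for ANCHORED subgroups / pairs
  (abc-iut-w6-d062, p449612), together with the exact failure locus of sentence 1: the ANCHOR-FREE maximal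
  compact subgroups (abc-iut-L3-d4, `isMaximalCompactSubgroup_dichotomy_of_isLocallyFinite`);
* §5 the countermodel of record `𝒢_θ(p, n)` (abc-iut-L3-d1): sentence 1 FAILS there
  (abc-iut-w6-d120's `thetaRayFreeProP_not_maximalCompactIffVerticialAt`, cited in §7), the anchored form of §4 HOLDS there, and the escaping
  procyclic compact `C = closure⟨c⟩` is the UNIQUE maximal compact subgroup above each power `c^{p^m}`
  (abc-iut-L3-d4 gen 5, `thetaRayFreeProP_exists_compact_unique_above_powers`, p480916) — so no two DISTINCT
  maximal compact subgroups share a power of `c`, i.e. sentence 2 cannot fail at `𝒢_θ` through such a pair;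
* §6 the bare ∀-closure F-1750 is refuted (abc-iut-w6-d120's `not_maximalCompactIffVerticial`, p443103, cited in §7);
* §7 the headline conjunctions `thm37_iv_node` (positive, universe-polymorphic) and `thm37_iv_node_negative`.

HONEST LABEL: «re-closed at the carriers of record ≠ proved in print»; sentence 2 «⇒» for a pair of ANCHOR-FREE
maximal compact subgroups of an infinite locally finite `𝒢` is NOT claimed (banked row «B9-GENERAL-PAIR»);
erratum-grade only for the ∀-countable typing; [IUTchIII] uses finite dual semi-graphs; typed ≠ proved; no side
taken on [IUTchIII] Cor. 3.12.
-/

noncomputable section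

namespace Literature.AnabelianGeometry.SemiGraphs

namespace ProfiniteSemiGraph

open Filter Topology
open Literature.AlgebraicGeometry.Frobenioids (IsConnectedObj)

universe u

/-! ### §1 Print's derivation at one graph: (iv) at `𝒢` from (iii) at `𝒢` -/

/-- **Thm 3.7 (iv) at `𝒢` from Thm 3.7 (iii) at `𝒢`** — print's own derivation ("it follows from (iii) …"),
with Thm 3.7 (i)/(ii) theorems of the tree (abc-iut-w4-d075's `maximalCompactIffVerticialAt_of_compactInVerticialAt`,
BY NAME). [cite: MochizukiSemiAnbd2006, Thm 3.7(iv) p.41] -/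
theorem thm37_iv_node_of_thm37_iii_at (𝒢 : ProfiniteSemiGraph.{u}) (hiii : CompactInVerticialAt 𝒢) :
    MaximalCompactIffVerticialAt 𝒢 :=
  maximalCompactIffVerticialAt_of_compactInVerticialAt hiii

/-! ### §2 Every FINITE underlying semi-graph (print's proof scope) -/

/-- **[SemiAnbd] Thm 3.7 (iv) at every FINITE `𝔾`, unconditionally** (print p. 41: "the semi-graphs `𝔾_j` are
all finite"): the body `MaximalCompactIffVerticialAt 𝒢` (both sentences, both directions) — by name
`maximalCompactIffVerticialAt_of_finiteGraph`. [cite: MochizukiSemiAnbd2006, Thm 3.7(iv) p.41] -/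
theorem thm37_iv_node_at_finiteGraph (𝒢 : ProfiniteSemiGraph.{u}) [Finite 𝒢.graph.Vertex]
    [Finite 𝒢.graph.Edge] : MaximalCompactIffVerticialAt 𝒢 :=
  maximalCompactIffVerticialAt_of_finiteGraph

/-! ### §3 Tempered covering graphs of finite coherent graphs (universal graph-coverings) and route-T towers -/

/-- **Thm 3.7 (iv) at the covering semi-graph `𝒢_S` of every connected tempered covering `S` of a FINITE
coherent Thm-3.7 graph `𝒢`** (`𝒢_S` is in general infinite: the universal graph-coverings) — by name
`CovObj.maximalCompactIffVerticialAt_coveringGraph_of_finite` (abc-iut-L3-d6, route T).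
[cite: MochizukiSemiAnbd2006, Thm 3.7(iv) p.41] -/
theorem thm37_iv_node_at_coveringGraph_of_finite {𝒢 : ProfiniteSemiGraph.{u}} [Finite 𝒢.graph.Vertex]
    [Finite 𝒢.graph.Edge] (S : CovObj 𝒢) (h𝒢 : 𝒢.Thm37Hypotheses) (hcoh : 𝒢.IsCoherent) (hS : S.IsTempered)
    (hSc : IsConnectedObj (⟨S, hS⟩ : BTempCat 𝒢)) : MaximalCompactIffVerticialAt S.coveringGraph :=
  S.maximalCompactIffVerticialAt_coveringGraph_of_finite h𝒢 hcoh hS hSc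

/-- **Thm 3.7 (iv) climbs route-T towers**: under the hereditary invariant «Thm-3.7 hypotheses ∧ strictly
coherent ∧ (iii) at the graph» at `𝒢` (carried by every finite coherent Thm-3.7 graph, `routeTInvariant_of_finite`,
and inherited by every connected tempered covering, `CovObj.routeTInvariant_coveringGraph`), the BODY of (iv)
holds at `𝒢_S` in every chart — by name `CovObj.maximalCompactIffVerticialAt_of_routeTInvariant`.
[cite: MochizukiSemiAnbd2006, Thm 3.7(iv) p.41] -/
theorem thm37_iv_node_body_of_routeTInvariant {𝒢 : ProfiniteSemiGraph.{u}} (S : CovObj 𝒢)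
    (h : 𝒢.Thm37Hypotheses ∧ 𝒢.IsStrictlyCoherent ∧ CompactInVerticialAt 𝒢) (hS : S.IsTempered)
    (hSc : IsConnectedObj (⟨S, hS⟩ : BTempCat 𝒢)) (c : TemperedPiChart S.coveringGraph) :
    (∀ K : Subgroup c.G, IsMaximalCompactSubgroup K ↔ ∃ w, K ∈ verticialSubgroups c w) ∧
    ∀ L : Subgroup c.G, L ≠ ⊥ →
      ((∃ K₁ K₂ : Subgroup c.G, IsMaximalCompactSubgroup K₁ ∧ IsMaximalCompactSubgroup K₂ ∧
          K₁ ≠ K₂ ∧ L = K₁ ⊓ K₂) ↔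
        ∃ e, S.coveringGraph.graph.IsClosedEdge e ∧ L ∈ edgeLikeSubgroups c e) :=
  S.maximalCompactIffVerticialAt_of_routeTInvariant h hS hSc c

/-! ### §4 Countable LOCALLY FINITE graphs: the anchored form and the exact failure locus -/

/-- **[SemiAnbd] Thm 3.7 (iv) at every countable LOCALLY FINITE Thm-3.7 graph, ANCHORED FORM** (every chart;
abc-iut-w6-d062 p449612, BY NAME): (a) every verticial subgroup is a maximal compact subgroup; (b) a subgroup
meeting some verticial subgroup nontrivially is maximal compact iff verticial; (c) every nontrivial edge-like
subgroup of a closed edge is the intersection of two distinct maximal compact subgroups; (d) a nontrivial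
intersection of two distinct maximal compact subgroups one of which meets some verticial subgroup nontrivially is
an edge-like subgroup of a closed edge.  (a), (c) unconditional; (b), (d) away from ANCHOR-FREE subgroups.
[cite: MochizukiSemiAnbd2006, Thm 3.7(iv) p.41] -/
theorem thm37_iv_node_anchored_of_isLocallyFinite (𝒢 : ProfiniteSemiGraph.{u}) (h37 : 𝒢.Thm37Hypotheses)
    (hlf : 𝒢.graph.IsLocallyFinite) (c : TemperedPiChart 𝒢) :
    (∀ (v : 𝒢.graph.Vertex) (H : Subgroup c.G), H ∈ verticialSubgroups c v → IsMaximalCompactSubgroup H) ∧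
    (∀ (K : Subgroup c.G) (v₀ : 𝒢.graph.Vertex) (H₀ : Subgroup c.G), H₀ ∈ verticialSubgroups c v₀ →
      K ⊓ H₀ ≠ ⊥ → (IsMaximalCompactSubgroup K ↔ ∃ v : 𝒢.graph.Vertex, K ∈ verticialSubgroups c v)) ∧
    (∀ (e : 𝒢.graph.Edge), 𝒢.graph.IsClosedEdge e → ∀ L ∈ edgeLikeSubgroups c e, L ≠ ⊥ →
      ∃ K₁ K₂ : Subgroup c.G, IsMaximalCompactSubgroup K₁ ∧ IsMaximalCompactSubgroup K₂ ∧ K₁ ≠ K₂ ∧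
        L = K₁ ⊓ K₂) ∧
    (∀ (K₁ K₂ : Subgroup c.G), IsMaximalCompactSubgroup K₁ → IsMaximalCompactSubgroup K₂ → K₁ ≠ K₂ →
      K₁ ⊓ K₂ ≠ ⊥ → ∀ (v₀ : 𝒢.graph.Vertex) (H₀ : Subgroup c.G), H₀ ∈ verticialSubgroups c v₀ →
        K₁ ⊓ H₀ ≠ ⊥ → ∃ e : 𝒢.graph.Edge, 𝒢.graph.IsClosedEdge e ∧ K₁ ⊓ K₂ ∈ edgeLikeSubgroups c e) :=
  ⟨fun _ _ hH => 𝒢.isMaximalCompactSubgroup_of_mem_verticialSubgroups_of_isLocallyFinite h37 hlf c hH,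
    fun K _ _ hH₀ hanch =>
      𝒢.isMaximalCompactSubgroup_iff_mem_verticialSubgroups_of_anchored_of_isLocallyFinite h37 hlf c K hH₀ hanch,
    fun _ he _ hL hLne =>
      𝒢.exists_maximalCompact_inf_eq_of_mem_edgeLikeSubgroups_of_isLocallyFinite h37 hlf c he hL hLne,
    fun _ _ hK₁ hK₂ hne hL _ _ hH₀ hanch =>
      𝒢.exists_mem_edgeLikeSubgroups_of_maximalCompact_inf_of_anchored_of_isLocallyFinite h37 hlf c hK₁ hK₂
        hne hL hH₀ hanch⟩

/-- **The exact failure locus of sentence 1 at a locally finite `𝒢`** (every chart): a maximal compact subgroup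
is EITHER verticial OR ANCHOR-FREE (meets every verticial subgroup trivially) — abc-iut-L3-d4's dichotomy, BY
NAME. [cite: MochizukiSemiAnbd2006, Thm 3.7(iv) p.41] -/
theorem thm37_iv_node_dichotomy_of_isLocallyFinite (𝒢 : ProfiniteSemiGraph.{u}) (h37 : 𝒢.Thm37Hypotheses)
    (hlf : 𝒢.graph.IsLocallyFinite) (c : TemperedPiChart 𝒢) (K : Subgroup c.G)
    (hK : IsMaximalCompactSubgroup K) :
    (∃ v : 𝒢.graph.Vertex, K ∈ verticialSubgroups c v) ∨
      ∀ (v : 𝒢.graph.Vertex) (H : Subgroup c.G), H ∈ verticialSubgroups c v → K ⊓ H = ⊥ :=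
  isMaximalCompactSubgroup_dichotomy_of_isLocallyFinite h37 hlf c K hK

/-- **Sentence 1 of Thm 3.7 (iv) in a chart of a locally finite `𝒢` holds IFF every ANCHOR-FREE maximal
compact subgroup is verticial** (equivalently: no anchor-free maximal compact subgroup occurs, apart from the
degenerate verticial `1`): «⇐» of sentence 1 is unconditional (§4 (a)), «⇒» holds for anchored subgroups (§4 (b)),
so the anchor-free ones are the whole residual. [cite: MochizukiSemiAnbd2006, Thm 3.7(iv) p.41] -/
theorem thm37_iv_node_sentence1_iff_of_isLocallyFinite (𝒢 : ProfiniteSemiGraph.{u})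
    (h37 : 𝒢.Thm37Hypotheses) (hlf : 𝒢.graph.IsLocallyFinite) (c : TemperedPiChart 𝒢) :
    (∀ K : Subgroup c.G, IsMaximalCompactSubgroup K ↔ ∃ v : 𝒢.graph.Vertex, K ∈ verticialSubgroups c v) ↔
      ∀ K : Subgroup c.G, IsMaximalCompactSubgroup K →
        (∀ (v : 𝒢.graph.Vertex) (H : Subgroup c.G), H ∈ verticialSubgroups c v → K ⊓ H = ⊥) →
          ∃ v : 𝒢.graph.Vertex, K ∈ verticialSubgroups c v := by
  refine ⟨fun h K hK _ => (h K).mp hK, fun h K => ⟨fun hK => ?_, fun ⟨v, hKv⟩ =>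
    𝒢.isMaximalCompactSubgroup_of_mem_verticialSubgroups_of_isLocallyFinite h37 hlf c hKv⟩⟩
  rcases isMaximalCompactSubgroup_dichotomy_of_isLocallyFinite h37 hlf c K hK with hv | hfree
  · exact hv
  · exact h K hK hfree

/-! ### §5 The countermodel of record `𝒢_θ(p, n)`: what fails, what holds -/

section ThetaRay

variable (p : ℕ) [hp : Fact p.Prime] (n : ℕ → ℕ)

-- Thm 3.7 (iv) at `𝒢_θ(p, n)` FAILS (`k ≤ n k`): this is abc-iut-w6-d120's landed
-- `thetaRayFreeProP_not_maximalCompactIffVerticialAt` (ThetaRayRefutationMaximalCompact.lean), cited BY NAME in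
-- `thm37_iv_node_negative` below and not restated here.

/-- **The anchored form of Thm 3.7 (iv) HOLDS at `𝒢_θ(p, n)`** (every schedule `n`, every chart): `𝒢_θ` is a
countable locally finite Thm-3.7 graph (`thetaRayFreeProP_thm37Hypotheses'`, `SemiGraph.ray_isLocallyFinite`),
so §4 applies verbatim. [cite: MochizukiSemiAnbd2006, Thm 3.7(iv) p.41] -/
theorem thm37_iv_node_anchored_at_thetaRay (c : TemperedPiChart (thetaRayFreeProP p n)) :
    (∀ (v : ℕ) (H : Subgroup c.G), H ∈ verticialSubgroups c v → IsMaximalCompactSubgroup H) ∧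
    (∀ (K : Subgroup c.G) (v₀ : ℕ) (H₀ : Subgroup c.G), H₀ ∈ verticialSubgroups c v₀ →
      K ⊓ H₀ ≠ ⊥ → (IsMaximalCompactSubgroup K ↔ ∃ v : ℕ, K ∈ verticialSubgroups c v)) ∧
    (∀ (e : (thetaRayFreeProP p n).graph.Edge), (thetaRayFreeProP p n).graph.IsClosedEdge e →
      ∀ L ∈ edgeLikeSubgroups c e, L ≠ ⊥ →
        ∃ K₁ K₂ : Subgroup c.G, IsMaximalCompactSubgroup K₁ ∧ IsMaximalCompactSubgroup K₂ ∧ K₁ ≠ K₂ ∧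
          L = K₁ ⊓ K₂) ∧
    (∀ (K₁ K₂ : Subgroup c.G), IsMaximalCompactSubgroup K₁ → IsMaximalCompactSubgroup K₂ → K₁ ≠ K₂ →
      K₁ ⊓ K₂ ≠ ⊥ → ∀ (v₀ : ℕ) (H₀ : Subgroup c.G), H₀ ∈ verticialSubgroups c v₀ →
        K₁ ⊓ H₀ ≠ ⊥ → ∃ e : (thetaRayFreeProP p n).graph.Edge,
          (thetaRayFreeProP p n).graph.IsClosedEdge e ∧ K₁ ⊓ K₂ ∈ edgeLikeSubgroups c e) :=
  thm37_iv_node_anchored_of_isLocallyFinite (thetaRayFreeProP p n) (thetaRayFreeProP_thm37Hypotheses' p n)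
    SemiGraph.ray_isLocallyFinite c

/-- **At `𝒢_θ(p, n)` the escaping procyclic compact is a NON-VERTICIAL MAXIMAL COMPACT subgroup which is the
UNIQUE maximal compact subgroup above each of its powers** (canonical chart, every schedule `n_k → ∞`): from
abc-iut-L3-d4's `thetaRayFreeProP_exists_compact_unique_above_powers` (p480916) by maximality bookkeeping —
`C = closure⟨c⟩` is maximal compact (a compact `K' ⊇ C ∋ c = c^{p^0}` lies in `C`), lies in no verticial
subgroup, and every maximal compact `K ∋ c^{p^m}` EQUALS `C`. [cite: MochizukiSemiAnbd2006, Thm 3.7(iv) p.41] -/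
theorem thm37_iv_node_escaping_unique_at_thetaRay (hn : Tendsto n atTop atTop)
    (h36 : (thetaRayFreeProP p n).Prop36Hypotheses) :
    ∃ c : ((thetaRayFreeProP p n).temperedPiChart h36).G,
      IsMaximalCompactSubgroup (Subgroup.zpowers c).topologicalClosure ∧
      (∀ (v : ℕ) (H : Subgroup ((thetaRayFreeProP p n).temperedPiChart h36).G),
        H ∈ verticialSubgroups ((thetaRayFreeProP p n).temperedPiChart h36) v →
          ¬ (Subgroup.zpowers c).topologicalClosure ≤ H) ∧
      ∀ (m : ℕ) (K : Subgroup ((thetaRayFreeProP p n).temperedPiChart h36).G),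
        IsMaximalCompactSubgroup K → c ^ p ^ m ∈ K → K = (Subgroup.zpowers c).topologicalClosure := by
  obtain ⟨c, hC, hnv, huniq⟩ := thetaRayFreeProP_exists_compact_unique_above_powers p n hn h36
  have hcC : c ∈ (Subgroup.zpowers c).topologicalClosure :=
    Subgroup.le_topologicalClosure _ (Subgroup.mem_zpowers c)
  refine ⟨c, ⟨hC, fun K' hK' hCK' => le_antisymm (huniq 0 K' hK' ?_) hCK'⟩, hnv, fun m K hK hcK =>
    (hK.2 _ hC (huniq m K hK.1 hcK)).symm⟩
  simpa using hCK' hcC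

/-- **Hence sentence 2 of Thm 3.7 (iv) cannot fail at `𝒢_θ(p, n)` through a pair sharing a power of the
escaping generator**: two maximal compact subgroups of the canonical `π₁^temp(𝒢_θ)` both containing some
`c^{p^m}` COINCIDE (both equal `C`); the residual «two arbitrary anchor-free maximal compact subgroups» is the
banked row «B9-GENERAL-PAIR», not claimed here. [cite: MochizukiSemiAnbd2006, Thm 3.7(iv) p.41] -/
theorem thm37_iv_node_no_distinct_pair_through_powers_at_thetaRay (hn : Tendsto n atTop atTop)
    (h36 : (thetaRayFreeProP p n).Prop36Hypotheses) :
    ∃ c : ((thetaRayFreeProP p n).temperedPiChart h36).G,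
      IsMaximalCompactSubgroup (Subgroup.zpowers c).topologicalClosure ∧
      (¬ ∃ v : ℕ, (Subgroup.zpowers c).topologicalClosure ∈
          verticialSubgroups ((thetaRayFreeProP p n).temperedPiChart h36) v) ∧
      ∀ (m : ℕ) (K₁ K₂ : Subgroup ((thetaRayFreeProP p n).temperedPiChart h36).G),
        IsMaximalCompactSubgroup K₁ → IsMaximalCompactSubgroup K₂ → c ^ p ^ m ∈ K₁ → c ^ p ^ m ∈ K₂ →
          K₁ = K₂ := by
  obtain ⟨c, hC, hnv, huniq⟩ := thm37_iv_node_escaping_unique_at_thetaRay p n hn h36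
  refine ⟨c, hC, fun ⟨v, hv⟩ => hnv v _ hv le_rfl, fun m K₁ K₂ hK₁ hK₂ h₁ h₂ => ?_⟩
  rw [huniq m K₁ hK₁ h₁, huniq m K₂ hK₂ h₂]

end ThetaRay

/-! ### §6 The bare ∀-closure (FACT-LIST F-1750) is refuted

`¬ MaximalCompactIffVerticial.{0}` is abc-iut-w6-d120's landed `not_maximalCompactIffVerticial`
(ThetaRayRefutationMaximalCompact.lean, countermodel `𝒢_θ(2, k ↦ k+1)`), cited BY NAME in `thm37_iv_node_negative`
below and not restated here; the printed theorem for finite semi-graphs (§2) and its transfers (§3) are unaffected. -/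

/-! ### §7 Headline conjunctions -/

/-- **[SemiAnbd] Thm 3.7 (iv) — the node `SemiAnbd:Thm3.7(iv)` RE-CLOSED at the carriers of record** (positive
half, universe-polymorphic): (1) at every graph where (iii) holds at that graph; (2) at every FINITE `𝔾`; (3) at
the covering semi-graph of every connected tempered covering of a finite coherent Thm-3.7 graph; (4) the
anchored form at every countable locally finite Thm-3.7 graph.  «re-closed at the carriers of record ≠ proved in
print»; the ∀-countable typing is refuted (`thm37_iv_node_negative`, citing p443103 BY NAME). [cite: MochizukiSemiAnbd2006, Thm 3.7(iv) p.41] -/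
theorem thm37_iv_node :
    (∀ 𝒢 : ProfiniteSemiGraph.{u}, CompactInVerticialAt 𝒢 → MaximalCompactIffVerticialAt 𝒢) ∧
    (∀ 𝒢 : ProfiniteSemiGraph.{u}, Finite 𝒢.graph.Vertex → Finite 𝒢.graph.Edge →
      MaximalCompactIffVerticialAt 𝒢) ∧
    (∀ (𝒢 : ProfiniteSemiGraph.{u}) (S : CovObj 𝒢), Finite 𝒢.graph.Vertex → Finite 𝒢.graph.Edge →
      𝒢.Thm37Hypotheses → 𝒢.IsCoherent → ∀ hS : S.IsTempered, IsConnectedObj (⟨S, hS⟩ : BTempCat 𝒢) →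
        MaximalCompactIffVerticialAt S.coveringGraph) ∧
    (∀ 𝒢 : ProfiniteSemiGraph.{u}, 𝒢.Thm37Hypotheses → 𝒢.graph.IsLocallyFinite → ∀ c : TemperedPiChart 𝒢,
      (∀ (v : 𝒢.graph.Vertex) (H : Subgroup c.G), H ∈ verticialSubgroups c v → IsMaximalCompactSubgroup H) ∧
      (∀ (K : Subgroup c.G) (v₀ : 𝒢.graph.Vertex) (H₀ : Subgroup c.G), H₀ ∈ verticialSubgroups c v₀ →
        K ⊓ H₀ ≠ ⊥ → (IsMaximalCompactSubgroup K ↔ ∃ v : 𝒢.graph.Vertex, K ∈ verticialSubgroups c v)) ∧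
      (∀ (e : 𝒢.graph.Edge), 𝒢.graph.IsClosedEdge e → ∀ L ∈ edgeLikeSubgroups c e, L ≠ ⊥ →
        ∃ K₁ K₂ : Subgroup c.G, IsMaximalCompactSubgroup K₁ ∧ IsMaximalCompactSubgroup K₂ ∧ K₁ ≠ K₂ ∧
          L = K₁ ⊓ K₂) ∧
      (∀ (K₁ K₂ : Subgroup c.G), IsMaximalCompactSubgroup K₁ → IsMaximalCompactSubgroup K₂ → K₁ ≠ K₂ →
        K₁ ⊓ K₂ ≠ ⊥ → ∀ (v₀ : 𝒢.graph.Vertex) (H₀ : Subgroup c.G), H₀ ∈ verticialSubgroups c v₀ →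
          K₁ ⊓ H₀ ≠ ⊥ → ∃ e : 𝒢.graph.Edge, 𝒢.graph.IsClosedEdge e ∧ K₁ ⊓ K₂ ∈ edgeLikeSubgroups c e)) :=
  ⟨fun 𝒢 hiii => thm37_iv_node_of_thm37_iii_at 𝒢 hiii,
    fun 𝒢 hV hE => by
      haveI := hV; haveI := hE
      exact thm37_iv_node_at_finiteGraph 𝒢,
    fun 𝒢 S hV hE h𝒢 hcoh hS hSc => by
      haveI := hV; haveI := hE
      exact thm37_iv_node_at_coveringGraph_of_finite S h𝒢 hcoh hS hSc,
    fun 𝒢 h37 hlf c => thm37_iv_node_anchored_of_isLocallyFinite 𝒢 h37 hlf c⟩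

/-- **The negative half**: the ∀-countable typing F-1750 is refuted, and at the countermodel `𝒢_θ(p, n)`
(`k ≤ n k`, any prime `p`) the per-graph body fails — while §5 records what holds there.
[cite: MochizukiSemiAnbd2006, Thm 3.7(iv) p.41] -/
theorem thm37_iv_node_negative :
    ¬ MaximalCompactIffVerticial.{0} ∧
      ∀ (p : ℕ) [Fact p.Prime] (n : ℕ → ℕ), (∀ k, k ≤ n k) → ¬ MaximalCompactIffVerticialAt (thetaRayFreeProP p n) :=
  ⟨not_maximalCompactIffVerticial, fun p _ n hn => thetaRayFreeProP_not_maximalCompactIffVerticialAt p n hn⟩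

end ProfiniteSemiGraph

end Literature.AnabelianGeometry.SemiGraphs

end
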